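import Summits.QuantumFields.YangMills.Theses.XiPowWidening

/-!
# Route `XiPowWidening` (QuantumFields / YangMills; closes the rung-R2ξ leaf `WeakCouplingRates.XiPow`, all compact simple `G`) —
# THE ASSEMBLY ITEM (stmt-QuantumFields-22471), PROVED:
# `CorrelatorRigidityG → WitnessStateFloorG → LimitPointsAreInvariantDLRG → FloorOfRigidityAndWitnessG → XiPowOfLimitPointFloorG → XiPow`

Pattern of `SmallFieldWideningAssembly` / `UnitScaleTiltAssembly`.  The route's deciding theorem `XiPowWidening.closes`
(planner ym-idea-1 g0, gate-rendered and kernel-checked in the Theses file: per `(G, r)`, the floor support applied to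
RIGIDITY, WITNESS and the DLR/invariance support, then the kernel transfer) IS the assembly item's statement; this file
records it BY NAME.

WHAT THIS IS NOT: not a proof of the cruxes r2 `CorrelatorRigidityG` (open-problem grade) nor r3 `WitnessStateFloorG`
(XL; bulk control = internal node of ColdBoxAllGroups); the three supports are proved in the sibling files
`XiPowWideningLimitPointsAreInvariantDLRG`, `XiPowWideningFloorOfRigidityAndWitnessG`, `XiPowWideningXiPowOfLimitPointFloorG`.
Not a mass gap, not Clay: the route bears on the RECORD rung R2ξ (an UPPER bound `≤ β^(−ε)` on the gap), and no summit is
proved by it.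
-/

namespace Summit.QuantumFields.YangMills.Theorems

/-- **THE ASSEMBLY ITEM OF ROUTE `XiPowWidening`, PROVED**: `CorrelatorRigidityG → WitnessStateFloorG →
LimitPointsAreInvariantDLRG → FloorOfRigidityAndWitnessG → XiPowOfLimitPointFloorG → XiPow` — the gate's kernel-checked
deciding theorem `XiPowWidening.closes` by name. -/
theorem xiPowWidening_assembly_proof : Summit.QuantumFields.YangMills.Theses.XiPowWidening.Assembly :=
  fun hR hW hL hF hX => Summit.QuantumFields.YangMills.Theses.XiPowWidening.closes hR hW hL hF hX

end Summit.QuantumFields.YangMills.Theorems
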